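import Mathlib
import Literature.MathematicalPhysics.MHD.SolovevSolutions
import HarnessLib

/-!
# The CHEASE / Lee–Cerfon Solov'ev test equilibrium and its printed exact safety factor (as printed, proved)

Lee–Cerfon, *ECOM: A fast and accurate solver for toroidal axisymmetric MHD equilibria*, Comput. Phys.
Commun. 190 (2015) 72–88 (arXiv:1409.3523) §4.1 «Example 1: Solov'ev profiles» — bib `LeeCerfon2015`;
locator read on the page by the typer (LADDER-GRIDFUSION seat gridfusion-model-5, 2026-08-26; corpus
arXiv:1409.3523 chunk p0013): profiles `μ₀ p(Ψ) = −C_s Ψ`, `F(Ψ) = F_B` so `Δ*Ψ = C_s R²`, the up–down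
symmetric solution (their eq. (solo2), the CHEASE test case of Lütjens–Bondeson–Sauter 1996)
`Ψ = (κF_B/(2R₀³q₀))[¼(R²−R₀²)² + R²Z²/κ² − a²R₀²]`, boundary parametrisation `R² = R₀² + 2aR₀ cos t`,
`Z = κa(R₀/R) sin t`, axis flux (psi0), the EXACT safety factor on every surface
`q(Ψ_s) = (F_B/π)∫ dR/(R|∂_ZΨ|) = (2q₀/π)(R₀³/(R_min²R_max)) E(k)` (their (q4)) and test parameters
`R₀ = 1`, `a/R₀ = 0.32`, `κ = 1.7`, `F_B = 1`, `q₀ = 1`.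

PROVED here: (solo2) solves `Δ*Ψ = C_sR²` and, with its profiles, the Grad–Shafranov equation (6.15); its
axis data; **`q₀` is its on-axis safety factor in the sense of Freidberg (6.42)** and `Ψ_RR/Ψ_ZZ = κ²`;
and **PCF's `Ψ_exact` (`SolovevSolutions.psiPCF`) is a member of this family** (`psiPCF_eq_LCform`:
axis radius² `u₀` with `(1/2 + 4d₃)u₀ = −2d₂`, elongation² `−(1/2+4d₃)/(4d₃)`), so the printed closed form
(q4) applies to every PCF instance. NOT proved (named fact `QLCClosedForm`): the elliptic-integral
evaluation (q4) itself (Gradshteyn–Ryzhik 3.156.6 in the source). PROVENANCE note: the printed (psi0)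
`Ψ₀ = −κa²/(2R₀q₀)` is the `F_B = 1` value; the identity proved here carries `F_B`.
HONEST FRAMING: model objects (ideal MHD, Solov'ev profiles, analytic fixed boundary); a certified
enclosure of `qLC`/`qLCIntegral` on a named surface is a Bench-file matter (two quadrature lineages);
nothing here says anything is stable. Private calculus helpers duplicate those of `SolovevSolutions.lean`
(private there).
-/

noncomputable section

namespace Literature.MathematicalPhysics.MHD.Solovev

open GradShafranov _root_.Real

/-! ## Calculus helpers -/

/-- Derivative of the even sextic `a + b r² + c r⁴ + e r⁶`. [folklore] -/
private theorem lc_hasDerivAt_evenSextic (a b c e r : ℝ) :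
    HasDerivAt (fun r => a + b * r ^ 2 + c * r ^ 4 + e * r ^ 6)
      (2 * b * r + 4 * c * r ^ 3 + 6 * e * r ^ 5) r := by
  have h := (((hasDerivAt_const r a).fun_add ((hasDerivAt_pow 2 r).const_mul b)).fun_add
    ((hasDerivAt_pow 4 r).const_mul c)).fun_add ((hasDerivAt_pow 6 r).const_mul e)
  exact h.congr_deriv (by norm_num; ring)

/-- Derivative of the odd quintic `2b z + 4c z³ + 6e z⁵`. [folklore] -/
private theorem lc_hasDerivAt_oddQuintic (b c e z : ℝ) :
    HasDerivAt (fun z => 2 * b * z + 4 * c * z ^ 3 + 6 * e * z ^ 5)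
      (2 * b + 12 * c * z ^ 2 + 30 * e * z ^ 4) z := by
  have h := (((hasDerivAt_id' z).const_mul (2 * b)).fun_add
    ((hasDerivAt_pow 3 z).const_mul (4 * c))).fun_add ((hasDerivAt_pow 5 z).const_mul (6 * e))
  exact h.congr_deriv (by norm_num; ring)

/-- `∂ψ/∂R` of an even sextic in `R` (coefficients may depend on the frozen `Z`). [folklore] -/
private theorem lc_dR_evenSextic {ψ : ℝ → ℝ → ℝ} {Z a b c e : ℝ}
    (hψ : ∀ r, ψ r Z = a + b * r ^ 2 + c * r ^ 4 + e * r ^ 6) (R : ℝ) :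
    dR ψ R Z = 2 * b * R + 4 * c * R ^ 3 + 6 * e * R ^ 5 := by
  unfold dR
  rw [show (fun r => ψ r Z) = fun r => a + b * r ^ 2 + c * r ^ 4 + e * r ^ 6 from funext hψ]
  exact (lc_hasDerivAt_evenSextic a b c e R).deriv

/-- `∂ψ/∂Z` of an even sextic in `Z` (coefficients may depend on the frozen `R`). [folklore] -/
private theorem lc_dZ_evenSextic {ψ : ℝ → ℝ → ℝ} {R a b c e : ℝ}
    (hψ : ∀ z, ψ R z = a + b * z ^ 2 + c * z ^ 4 + e * z ^ 6) (Z : ℝ) :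
    dZ ψ R Z = 2 * b * Z + 4 * c * Z ^ 3 + 6 * e * Z ^ 5 := by
  unfold dZ
  rw [show ψ R = fun z => a + b * z ^ 2 + c * z ^ 4 + e * z ^ 6 from funext hψ]
  exact (lc_hasDerivAt_evenSextic a b c e Z).deriv

/-- `∂²ψ/∂R²` of an even sextic in `R`. [folklore] -/
private theorem lc_dRR_evenSextic {ψ : ℝ → ℝ → ℝ} {Z a b c e : ℝ}
    (hψ : ∀ r, ψ r Z = a + b * r ^ 2 + c * r ^ 4 + e * r ^ 6) (R : ℝ) :
    dRR ψ R Z = 2 * b + 12 * c * R ^ 2 + 30 * e * R ^ 4 := by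
  unfold dRR
  rw [show (fun r => ψ r Z) = fun r => a + b * r ^ 2 + c * r ^ 4 + e * r ^ 6 from funext hψ,
    show (2 : ℕ) = 1 + 1 from rfl, iteratedDeriv_succ, iteratedDeriv_one,
    show deriv (fun r => a + b * r ^ 2 + c * r ^ 4 + e * r ^ 6)
        = fun r => 2 * b * r + 4 * c * r ^ 3 + 6 * e * r ^ 5
      from funext fun r => (lc_hasDerivAt_evenSextic a b c e r).deriv]
  exact (lc_hasDerivAt_oddQuintic b c e R).deriv

/-- `∂²ψ/∂Z²` of an even sextic in `Z`. [folklore] -/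
private theorem lc_dZZ_evenSextic {ψ : ℝ → ℝ → ℝ} {R a b c e : ℝ}
    (hψ : ∀ z, ψ R z = a + b * z ^ 2 + c * z ^ 4 + e * z ^ 6) (Z : ℝ) :
    dZZ ψ R Z = 2 * b + 12 * c * Z ^ 2 + 30 * e * Z ^ 4 := by
  unfold dZZ
  rw [show ψ R = fun z => a + b * z ^ 2 + c * z ^ 4 + e * z ^ 6 from funext hψ,
    show (2 : ℕ) = 1 + 1 from rfl, iteratedDeriv_succ, iteratedDeriv_one,
    show deriv (fun z => a + b * z ^ 2 + c * z ^ 4 + e * z ^ 6)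
        = fun z => 2 * b * z + 4 * c * z ^ 3 + 6 * e * z ^ 5
      from funext fun z => (lc_hasDerivAt_evenSextic a b c e z).deriv]
  exact (lc_hasDerivAt_oddQuintic b c e Z).deriv

/-- Radial part of `Δ*` for an even sextic in `R`: `R ∂_R(R⁻¹ ∂_R ψ) = 8c R² + 24e R⁴` at `R ≠ 0`.
[folklore] -/
private theorem lc_radialPart_evenSextic {ψ : ℝ → ℝ → ℝ} {Z a b c e R : ℝ} (hR : R ≠ 0)
    (hψ : ∀ r, ψ r Z = a + b * r ^ 2 + c * r ^ 4 + e * r ^ 6) :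
    R * deriv (fun r => r⁻¹ * dR ψ r Z) R = 8 * c * R ^ 2 + 24 * e * R ^ 4 := by
  have hfun : (fun r => r⁻¹ * dR ψ r Z) =ᶠ[nhds R]
      fun r => 2 * b + (4 * c) * r ^ 2 + (6 * e) * r ^ 4 + 0 * r ^ 6 := by
    filter_upwards [isOpen_ne.mem_nhds hR] with r hr
    rw [lc_dR_evenSextic hψ r]
    field_simp
    ring
  rw [hfun.deriv_eq, (lc_hasDerivAt_evenSextic (2 * b) (4 * c) (6 * e) 0 R).deriv]
  ring

/-- `Δ*` of `ψ` when `r ↦ ψ(r, Z)` is the even sextic `a + b r² + c r⁴ + e r⁶` and `z ↦ ψ(R, z)` is the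
even sextic `a' + b' z² + c' z⁴ + e' z⁶`: `Δ*ψ(R,Z) = 8cR² + 24eR⁴ + 2b' + 12c'Z² + 30e'Z⁴`
(`R ≠ 0`). [folklore] -/
private theorem lc_gsOperator_evenSextic {ψ : ℝ → ℝ → ℝ} {R Z a b c e a' b' c' e' : ℝ} (hR : R ≠ 0)
    (hR' : ∀ r, ψ r Z = a + b * r ^ 2 + c * r ^ 4 + e * r ^ 6)
    (hZ' : ∀ z, ψ R z = a' + b' * z ^ 2 + c' * z ^ 4 + e' * z ^ 6) :
    gsOperator ψ R Z
      = 8 * c * R ^ 2 + 24 * e * R ^ 4 + (2 * b' + 12 * c' * Z ^ 2 + 30 * e' * Z ^ 4) := by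
  unfold gsOperator
  rw [lc_radialPart_evenSextic hR hR', lc_dZZ_evenSextic hZ' Z]


/-! ## The CHEASE / Lee–Cerfon Solov'ev test equilibrium and its printed exact safety factor

Lee–Cerfon, Comput. Phys. Commun. 190 (2015) 72–88 (arXiv:1409.3523) §4.1 «Example 1: Solov'ev profiles»
[bib `LeeCerfon2015`; locator read on the page by the typer: corpus arXiv:1409.3523 chunk p0013]: profiles
`μ₀ p(Ψ) = −C_s Ψ`, `F(Ψ) = F_B`, so `Δ*Ψ = C_s R²`, with the up–down symmetric solution (their eq. (solo2),
attributed to Lütjens–Bondeson–Sauter 1996 = the CHEASE test case) typed below; printed test parameters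
`R₀ = 1`, `a/R₀ = 0.32`, `κ = 1.7`, `F_B = 1`, `q₀ = 1`. The family is the same 3-parameter polynomial
span as PCF's (`psiLC_expand` / `psiPCF_eq_LCform`), so every PCF instance inherits the printed
closed-form safety factor `q(Ψ_s) = (2q₀/π)(R₀³/(R_min² R_max)) E(k)` (their eq. (q4); typed as the
functional `qLC` and the named fact `QLCClosedForm`, NOT re-proved here). -/

/-- The CHEASE/Lee–Cerfon Solov'ev solution `Ψ = (κF_B/(2R₀³q₀))[¼(R²−R₀²)² + R²Z²/κ² − a²R₀²]`
(`R₀` axis radius, `q₀` on-axis safety factor, `a`, `κ` effective minor radius / elongation of `Ψ = 0`).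
[cite: LeeCerfon2015, §4.1 eq. (solo2)] -/
def psiLC (κ FB R₀ q₀ a : ℝ) (R Z : ℝ) : ℝ :=
  κ * FB / (2 * R₀ ^ 3 * q₀) * (1 / 4 * (R ^ 2 - R₀ ^ 2) ^ 2 + R ^ 2 * Z ^ 2 / κ ^ 2 - a ^ 2 * R₀ ^ 2)

/-- The source constant `C_s = F_B(κ + 1/κ)/(R₀³q₀)` of `Δ*Ψ = C_sR²`. [cite: LeeCerfon2015, §4.1] -/
def csLC (κ FB R₀ q₀ : ℝ) : ℝ := FB * (κ + 1 / κ) / (R₀ ^ 3 * q₀)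

/-- **(solo2) solves `Δ*Ψ = C_s R²`** (`R, R₀, κ, q₀ ≠ 0`). [cite: LeeCerfon2015, §4.1 eq. (solo2)] -/
theorem gsOperator_psiLC {κ FB R₀ q₀ a R : ℝ} (Z : ℝ) (hR : R ≠ 0) (hR₀ : R₀ ≠ 0) (hκ : κ ≠ 0)
    (hq : q₀ ≠ 0) : gsOperator (psiLC κ FB R₀ q₀ a) R Z = csLC κ FB R₀ q₀ * R ^ 2 := by
  set k := κ * FB / (2 * R₀ ^ 3 * q₀) with hk
  rw [lc_gsOperator_evenSextic (ψ := psiLC κ FB R₀ q₀ a) (a := k * (1 / 4 * R₀ ^ 4 - a ^ 2 * R₀ ^ 2))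
    (b := k * (Z ^ 2 / κ ^ 2 - 1 / 2 * R₀ ^ 2)) (c := k * (1 / 4)) (e := 0)
    (a' := k * (1 / 4 * (R ^ 2 - R₀ ^ 2) ^ 2 - a ^ 2 * R₀ ^ 2)) (b' := k * (R ^ 2 / κ ^ 2)) (c' := 0)
    (e' := 0) hR (fun r => by unfold psiLC; rw [hk]; ring) (fun z => by unfold psiLC; rw [hk]; ring)]
  rw [hk]; unfold csLC; field_simp; ring

/-- (solo2) has Solov'ev profiles `p(Ψ) = −C_sΨ/μ₀`, `F ≡ F_B`: `A = 0`, `C = C_s` (`μ₀ ≠ 0`).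
[cite: LeeCerfon2015, §4.1] -/
theorem isSolovevProfile_LC {μ0 κ FB R₀ q₀ : ℝ} (hμ : μ0 ≠ 0) :
    IsSolovevProfile μ0 (fun s => -(csLC κ FB R₀ q₀) * s / μ0) (fun _ => FB) 0 (csLC κ FB R₀ q₀) := by
  intro s
  have hF : HasDerivAt (fun _ : ℝ => FB) 0 s := hasDerivAt_const s FB
  have hp : HasDerivAt (fun s => -(csLC κ FB R₀ q₀) * s / μ0) (-(csLC κ FB R₀ q₀) * 1 / μ0) s :=
    ((hasDerivAt_id s).const_mul _).div_const μ0
  refine ⟨hF.differentiableAt, by rw [hF.deriv]; ring, ?_⟩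
  rw [hp.deriv]; field_simp

/-- **The triple `(Ψ, p, F)` of Lee–Cerfon §4.1 solves the Grad–Shafranov equation (6.15)** on `{R ≠ 0}`.
[cite: LeeCerfon2015, §4.1 eq. (solo2)] -/
theorem isGSSolutionOn_LC {μ0 κ FB R₀ q₀ : ℝ} (a : ℝ) (hμ : μ0 ≠ 0) (hR₀ : R₀ ≠ 0) (hκ : κ ≠ 0)
    (hq : q₀ ≠ 0) :
    IsGSSolutionOn {x : ℝ × ℝ | x.1 ≠ 0} (psiLC κ FB R₀ q₀ a) μ0
      (fun s => -(csLC κ FB R₀ q₀) * s / μ0) (fun _ => FB) := by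
  rw [isGSSolutionOn_iff_solovev (isSolovevProfile_LC hμ)]
  intro R Z h
  rw [gsOperator_psiLC Z h hR₀ hκ hq]
  ring

/-- Axis data of (solo2): `∇Ψ(R₀,0) = 0`, `Ψ(R₀,0) = −κF_B a²/(2R₀q₀)` (the source prints eq. (psi0)
`Ψ₀ = −κa²/(2R₀q₀)`, i.e. the value for its test normalisation `F_B = 1` — PROVENANCE note: the general
identity carries the factor `F_B`), `Ψ_RR(R₀,0) = κF_B/(R₀q₀)`, `Ψ_ZZ(R₀,0) = F_B/(κR₀q₀)`
(`R₀, κ, q₀ ≠ 0`). [cite: LeeCerfon2015, §4.1 eq. (psi0)] -/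
theorem psiLC_axis {κ FB R₀ q₀ : ℝ} (a : ℝ) (hR₀ : R₀ ≠ 0) (hκ : κ ≠ 0) (hq : q₀ ≠ 0) :
    IsCriticalPoint (psiLC κ FB R₀ q₀ a) R₀ 0 ∧
      psiLC κ FB R₀ q₀ a R₀ 0 = -(κ * FB * a ^ 2 / (2 * R₀ * q₀)) ∧
      dRR (psiLC κ FB R₀ q₀ a) R₀ 0 = κ * FB / (R₀ * q₀) ∧
      dZZ (psiLC κ FB R₀ q₀ a) R₀ 0 = FB / (κ * R₀ * q₀) := by
  set k := κ * FB / (2 * R₀ ^ 3 * q₀) with hk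
  have hRsl : ∀ r, psiLC κ FB R₀ q₀ a r 0 = k * (1 / 4 * R₀ ^ 4 - a ^ 2 * R₀ ^ 2)
      + k * (0 ^ 2 / κ ^ 2 - 1 / 2 * R₀ ^ 2) * r ^ 2 + k * (1 / 4) * r ^ 4 + 0 * r ^ 6 :=
    fun r => by unfold psiLC; rw [hk]; ring
  have hZsl : ∀ z, psiLC κ FB R₀ q₀ a R₀ z = k * (1 / 4 * (R₀ ^ 2 - R₀ ^ 2) ^ 2 - a ^ 2 * R₀ ^ 2)
      + k * (R₀ ^ 2 / κ ^ 2) * z ^ 2 + 0 * z ^ 4 + 0 * z ^ 6 := fun z => by unfold psiLC; rw [hk]; ring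
  refine ⟨⟨?_, ?_⟩, ?_, ?_, ?_⟩
  · rw [lc_dR_evenSextic hRsl]; ring
  · rw [lc_dZ_evenSextic hZsl]; ring
  · unfold psiLC; field_simp; ring
  · rw [lc_dRR_evenSextic hRsl, hk]; field_simp; ring
  · rw [lc_dZZ_evenSextic hZsl, hk]; field_simp; ring

/-- **`q₀` IS the on-axis safety factor of (solo2)** in the sense of Freidberg (6.42) (`B_φ(axis) = F_B/R₀`):
`safetyFactorOnAxis F_B R₀ Ψ_RR Ψ_ZZ = q₀`, and `Ψ_RR/Ψ_ZZ = κ²` (`F_B, R₀, κ, q₀ > 0`).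
[cite: LeeCerfon2015, §4.1] -/
theorem safetyFactorOnAxis_LC {κ FB R₀ q₀ : ℝ} (a : ℝ) (hF : 0 < FB) (hR₀ : 0 < R₀) (hκ : 0 < κ)
    (hq : 0 < q₀) :
    safetyFactorOnAxis FB R₀ (dRR (psiLC κ FB R₀ q₀ a) R₀ 0) (dZZ (psiLC κ FB R₀ q₀ a) R₀ 0) = q₀ ∧
      dRR (psiLC κ FB R₀ q₀ a) R₀ 0 / dZZ (psiLC κ FB R₀ q₀ a) R₀ 0 = κ ^ 2 := by
  obtain ⟨-, -, hRR, hZZ⟩ := psiLC_axis (FB := FB) a hR₀.ne' hκ.ne' hq.ne'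
  rw [hRR, hZZ]
  constructor
  · unfold safetyFactorOnAxis
    have : κ * FB / (R₀ * q₀) * (FB / (κ * R₀ * q₀)) = (FB / (R₀ * q₀)) ^ 2 := by field_simp
    rw [this, Real.sqrt_sq (by positivity)]
    field_simp
  · field_simp

/-- Expansion of (solo2) in the monomials `R⁴, R², 1, R²Z²`: with `c := κF_B/(2R₀³q₀)`,
`Ψ = (c/4)R⁴ − (cR₀²/2)R² + c(R₀⁴/4 − a²R₀²) + (c/κ²)R²Z²`. [cite: LeeCerfon2015, §4.1 eq. (solo2)] -/
theorem psiLC_expand (κ FB R₀ q₀ a R Z : ℝ) :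
    psiLC κ FB R₀ q₀ a R Z
      = κ * FB / (2 * R₀ ^ 3 * q₀) / 4 * R ^ 4 - κ * FB / (2 * R₀ ^ 3 * q₀) * R₀ ^ 2 / 2 * R ^ 2
        + κ * FB / (2 * R₀ ^ 3 * q₀) * (R₀ ^ 4 / 4 - a ^ 2 * R₀ ^ 2)
        + κ * FB / (2 * R₀ ^ 3 * q₀) / κ ^ 2 * (R ^ 2 * Z ^ 2) := by
  unfold psiLC; ring

/-- **PCF's `Ψ_exact` lies in the CHEASE/Lee–Cerfon family:** writing `c := 1/2 + 4d₃`, one has for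
all `(R, Z)`
`psiPCF d₁ d₂ d₃ R Z = (c/4)(R² − u₀)² − 4d₃ R²Z² + (d₁ − c u₀²/4)` whenever `c u₀ = −2d₂`
— i.e. axis radius² `R₀² = u₀` (`= 1 + ε²` for a shape-fitted instance), elongation² `κ² = −c/(4d₃)`, and overall factor `c = κF_B/(2R₀³q₀)`,
so `q₀/F_B = κ/(2R₀³c)`; the printed closed-form `q(Ψ_s)` of (q4) therefore applies to every PCF instance.
[cite: LeeCerfon2015, §4.1 eq. (solo2)] -/
theorem psiPCF_eq_LCform {d₁ d₂ d₃ u₀ : ℝ} (hu : (1 / 2 + 4 * d₃) * u₀ = -(2 * d₂)) (R Z : ℝ) :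
    psiPCF d₁ d₂ d₃ R Z
      = (1 / 2 + 4 * d₃) / 4 * (R ^ 2 - u₀) ^ 2 - 4 * d₃ * (R ^ 2 * Z ^ 2)
        + (d₁ - (1 / 2 + 4 * d₃) * u₀ ^ 2 / 4) := by
  unfold psiPCF
  linear_combination (R ^ 2 / 2) * hu

/-- The complete elliptic integral of the second kind `E(k) = ∫₀^{π/2} (1 − k² sin²θ)^{1/2} dθ` (Mathlib has
no named version; used by the printed formula (q4)). [cite: LeeCerfon2015, §4.1 eq. (q4)] -/
def ellipticE (k : ℝ) : ℝ := ∫ θ in (0 : ℝ)..(π / 2), Real.sqrt (1 - k ^ 2 * Real.sin θ ^ 2)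

/-- The complete elliptic integral of the first kind `K(k) = ∫₀^{π/2} (1 − k² sin²θ)^{−1/2} dθ` (used by
the printed shear formula). [cite: LeeCerfon2015, §4.1 eq. (shat)] -/
def ellipticK (k : ℝ) : ℝ := ∫ θ in (0 : ℝ)..(π / 2), 1 / Real.sqrt (1 - k ^ 2 * Real.sin θ ^ 2)

/-- The printed closed form of the safety factor of (solo2) on the surface whose midplane radii are
`R_min < R_max` (`R_max² + R_min² = 2R₀²`): `q = (2q₀/π)(R₀³/(R_min² R_max)) E(k)`,
`k = (1 − R_min²/R_max²)^{1/2}`. [cite: LeeCerfon2015, §4.1 eq. (q4)] -/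
def qLC (q₀ R₀ Rmin Rmax : ℝ) : ℝ :=
  2 * q₀ / π * (R₀ ^ 3 / (Rmin ^ 2 * Rmax)) * ellipticE (Real.sqrt (1 - Rmin ^ 2 / Rmax ^ 2))

/-- The integral form of the same safety factor AS PRINTED (first line of (q4)), valid on a surface that is a
graph over the midplane: `q(Ψ_s) = (F_B/π) ∫_{R_min}^{R_max} dR/(R |∂Ψ/∂Z|)` evaluated on `Ψ = Ψ_s`
(the integrand uses the explicit upper branch `Z(R)`), here for (solo2) where
`R|∂_ZΨ| = (2q₀R₀³)⁻¹ … ` reduces to `(2q₀R₀³/π)∫ dR/(R²((R²−R_min²)(R_max²−R²))^{1/2})` (second line).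
[cite: LeeCerfon2015, §4.1 eq. (q4)] -/
def qLCIntegral (q₀ R₀ Rmin Rmax : ℝ) : ℝ :=
  2 * q₀ * R₀ ^ 3 / π * ∫ R in Rmin..Rmax, 1 / (R ^ 2 * Real.sqrt ((R ^ 2 - Rmin ^ 2) * (Rmax ^ 2 - R ^ 2)))

/-- NAMED FACT (published closed-form evaluation, Gradshteyn–Ryzhik 3.156.6 as used in the source; not
re-proved here): for `0 < R_min < R_max`, the elliptic-type flux integral of (q4) equals the closed form,
`qLCIntegral q₀ R₀ R_min R_max = qLC q₀ R₀ R_min R_max`. [cite: LeeCerfon2015, §4.1 eq. (q4)] -/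
def QLCClosedForm : Prop :=
  ∀ q₀ R₀ Rmin Rmax : ℝ, 0 < Rmin → Rmin < Rmax → qLCIntegral q₀ R₀ Rmin Rmax = qLC q₀ R₀ Rmin Rmax

/-! ## Discharge of the named fact `QLCClosedForm` (appended 2026-08-26, LADDER-GRIDFUSION seat gridfusion-lit-4)

The named fact `QLCClosedForm` above — the last equality of Lee–Cerfon (q4), elliptic-type flux
integral = closed form with `E(k)`; the source says «`E(0) = π/2` and the integral formula 6 in Section
3.156 of [Gradshteyn–Ryzhik] were used to derive Eq. (q4)» [cite: LeeCerfon2015, §4.1; corpus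
arXiv:1409.3523 chunk p0013, read on the page] — is PROVED below (`QLCClosedForm_holds`,
`qLCIntegral_eq_qLC`), so the module docstring's sentence «NOT proved (named fact `QLCClosedForm`)» is
superseded. Route (self-contained; it is the derivation behind the table entry): the substitution
`R = R_min (1 − k² sin²θ)^{−1/2}`, `θ ∈ [0, π/2]`, `k² = 1 − R_min²/R_max²`, maps `[0, π/2]` monotonically
onto `[R_min, R_max]`, satisfies `(R² − R_min²)(R_max² − R²) = (R_min R_max k² sin θ cos θ)² / (1 − k² sin²θ)²`
there, and pulls the integrand `dR/(R²((R² − R_min²)(R_max² − R²))^{1/2})` back to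
`(1 − k² sin²θ)^{1/2} dθ/(R_min² R_max)`; Mathlib's one-dimensional change-of-variables theorem for
monotone maps (`MeasureTheory.integral_Icc_deriv_smul_of_deriv_nonneg`, which needs no integrability
hypothesis, so the two endpoint singularities of the `R`-integrand need no separate treatment) does the
rest. Also recorded: `E(0) = π/2`. HONEST FRAMING: pure real analysis about the typed
functionals `qLCIntegral`/`qLC`/`ellipticE`; nothing here is a statement about a device. -/

section QLCDischarge

open MeasureTheory Set

/-- `E(0) = π/2`. [cite: LeeCerfon2015, §4.1 (text after (q4))] -/
theorem ellipticE_zero : ellipticE 0 = π / 2 := by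
  simp [ellipticE]

/-- Derivative of the substitution map `θ ↦ R_min (1 − m sin²θ)^{−1/2}`. [folklore] -/
private theorem hasDerivAt_substRadius (Rmin m θ : ℝ) (hΔ : 0 < 1 - m * Real.sin θ ^ 2) :
    HasDerivAt (fun θ => Rmin / Real.sqrt (1 - m * Real.sin θ ^ 2))
      (Rmin * m * Real.sin θ * Real.cos θ /
        ((1 - m * Real.sin θ ^ 2) * Real.sqrt (1 - m * Real.sin θ ^ 2))) θ := by
  have hsin2 : HasDerivAt (fun θ => Real.sin θ ^ 2) (2 * Real.sin θ * Real.cos θ) θ :=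
    ((Real.hasDerivAt_sin θ).fun_pow 2).congr_deriv (by norm_num)
  have hΔ' : HasDerivAt (fun θ => 1 - m * Real.sin θ ^ 2) (-(m * (2 * Real.sin θ * Real.cos θ))) θ :=
    (hsin2.const_mul m).const_sub 1
  have hsqrtpos : 0 < Real.sqrt (1 - m * Real.sin θ ^ 2) := Real.sqrt_pos.2 hΔ
  have hsq : Real.sqrt (1 - m * Real.sin θ ^ 2) ^ 2 = 1 - m * Real.sin θ ^ 2 := Real.sq_sqrt hΔ.le
  refine ((hasDerivAt_const θ Rmin).fun_div (hΔ'.sqrt hΔ.ne') hsqrtpos.ne').congr_deriv ?_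
  rw [hsq]
  field_simp
  ring

/-- **The elliptic evaluation behind Lee–Cerfon (q4)** (Gradshteyn–Ryzhik §3.156-type): for
`0 < R_min < R_max`,
`∫_{R_min}^{R_max} dR / (R² ((R² − R_min²)(R_max² − R²))^{1/2}) = E(k) / (R_min² R_max)`,
`k = (1 − R_min²/R_max²)^{1/2}`, via the substitution `R = R_min (1 − k² sin²θ)^{−1/2}`,
`θ ∈ (0, π/2)`. [cite: LeeCerfon2015, §4.1 eq. (q4)] -/
theorem integral_qLC_kernel {Rmin Rmax : ℝ} (h0 : 0 < Rmin) (hlt : Rmin < Rmax) :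
    ∫ R in Rmin..Rmax, 1 / (R ^ 2 * Real.sqrt ((R ^ 2 - Rmin ^ 2) * (Rmax ^ 2 - R ^ 2)))
      = ellipticE (Real.sqrt (1 - Rmin ^ 2 / Rmax ^ 2)) / (Rmin ^ 2 * Rmax) := by
  have hRmax : 0 < Rmax := h0.trans hlt
  have hle : Rmin ≤ Rmax := hlt.le
  have hpi : (0 : ℝ) ≤ π / 2 := by positivity
  -- the modulus squared `m = k²`
  set m : ℝ := 1 - Rmin ^ 2 / Rmax ^ 2 with hm_def
  have hratio : Rmin ^ 2 / Rmax ^ 2 < 1 := by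
    rw [div_lt_one (by positivity)]
    exact pow_lt_pow_left₀ hlt h0.le two_ne_zero
  have hm0 : 0 < m := by rw [hm_def]; linarith
  have hmR : m * Rmax ^ 2 = Rmax ^ 2 - Rmin ^ 2 := by
    rw [hm_def]; field_simp
  -- `Δ θ = 1 − m sin² θ > 0`
  have hΔpos : ∀ θ : ℝ, 0 < 1 - m * Real.sin θ ^ 2 := by
    intro θ
    have hs : Real.sin θ ^ 2 ≤ 1 := by
      rw [sq_le_one_iff_abs_le_one]; exact Real.abs_sin_le_one θ
    have hm1 : m < 1 := by rw [hm_def]; linarith [show 0 < Rmin ^ 2 / Rmax ^ 2 by positivity]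
    nlinarith
  -- the integrand, the substitution and its derivative
  set g : ℝ → ℝ := fun R => 1 / (R ^ 2 * Real.sqrt ((R ^ 2 - Rmin ^ 2) * (Rmax ^ 2 - R ^ 2)))
    with hg_def
  set φ : ℝ → ℝ := fun θ => Rmin / Real.sqrt (1 - m * Real.sin θ ^ 2) with hφ_def
  set φ' : ℝ → ℝ := fun θ => Rmin * m * Real.sin θ * Real.cos θ /
      ((1 - m * Real.sin θ ^ 2) * Real.sqrt (1 - m * Real.sin θ ^ 2)) with hφ'_def
  have hcont : ContinuousOn φ (Icc 0 (π / 2)) := by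
    refine Continuous.continuousOn ?_
    rw [hφ_def]
    exact continuous_const.div (by fun_prop) fun θ => (Real.sqrt_pos.2 (hΔpos θ)).ne'
  have hderiv : ∀ θ ∈ Ioo 0 (π / 2), HasDerivAt φ (φ' θ) θ := fun θ _ =>
    hasDerivAt_substRadius Rmin m θ (hΔpos θ)
  have hpos_aux : ∀ θ ∈ Ioo 0 (π / 2), 0 < Real.sin θ ∧ 0 < Real.cos θ := by
    intro θ hθ
    exact ⟨Real.sin_pos_of_pos_of_lt_pi hθ.1 (hθ.2.trans (by linarith [Real.pi_pos])),
      Real.cos_pos_of_mem_Ioo ⟨by linarith [hθ.1, Real.pi_pos], hθ.2⟩⟩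
  have hnonneg : ∀ θ ∈ Ioo 0 (π / 2), 0 ≤ φ' θ := by
    intro θ hθ
    obtain ⟨hs, hc⟩ := hpos_aux θ hθ
    rw [hφ'_def]
    exact div_nonneg (mul_pos (mul_pos (mul_pos h0 hm0) hs) hc).le
      (mul_pos (hΔpos θ) (Real.sqrt_pos.2 (hΔpos θ))).le
  have hφ0 : φ 0 = Rmin := by simp [hφ_def]
  have hφ1 : φ (π / 2) = Rmax := by
    rw [hφ_def]
    dsimp only
    rw [Real.sin_pi_div_two, one_pow, mul_one, show 1 - m = (Rmin / Rmax) ^ 2 by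
      rw [hm_def, div_pow]; ring, Real.sqrt_sq (by positivity)]
    field_simp
  -- step 1: change of variables (no integrability hypothesis needed)
  have step1 : ∫ R in Icc Rmin Rmax, g R = ∫ θ in Icc 0 (π / 2), φ' θ • g (φ θ) := by
    have := integral_Icc_deriv_smul_of_deriv_nonneg (g := g) hcont hderiv hnonneg hpi
    rw [hφ0, hφ1] at this
    exact this.symm
  -- step 2: the pulled-back integrand is `√(1 − m sin²θ) / (R_min² R_max)` on the open interval
  have step2 : ∫ θ in Icc 0 (π / 2), φ' θ • g (φ θ)
      = ∫ θ in Icc 0 (π / 2), Real.sqrt (1 - m * Real.sin θ ^ 2) / (Rmin ^ 2 * Rmax) := by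
    rw [integral_Icc_eq_integral_Ioo, integral_Icc_eq_integral_Ioo]
    refine setIntegral_congr_fun measurableSet_Ioo fun θ hθ => ?_
    obtain ⟨hs, hc⟩ := hpos_aux θ hθ
    have hΔ := hΔpos θ
    have hsq : Real.sqrt (1 - m * Real.sin θ ^ 2) ^ 2 = 1 - m * Real.sin θ ^ 2 := Real.sq_sqrt hΔ.le
    have hsqpos : 0 < Real.sqrt (1 - m * Real.sin θ ^ 2) := Real.sqrt_pos.2 hΔ
    have hφ2 : φ θ ^ 2 = Rmin ^ 2 / (1 - m * Real.sin θ ^ 2) := by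
      rw [hφ_def]; dsimp only; rw [div_pow, hsq]
    have hΔne : (1 - m * Real.sin θ ^ 2) ≠ 0 := hΔ.ne'
    have hsc : Real.sin θ ^ 2 + Real.cos θ ^ 2 = 1 := Real.sin_sq_add_cos_sq θ
    have hA : φ θ ^ 2 - Rmin ^ 2 = Rmin ^ 2 * m * Real.sin θ ^ 2 / (1 - m * Real.sin θ ^ 2) := by
      rw [hφ2, eq_div_iff hΔne, sub_mul, div_mul_cancel₀ _ hΔne]
      ring
    have hB : Rmax ^ 2 - φ θ ^ 2 = Rmax ^ 2 * m * Real.cos θ ^ 2 / (1 - m * Real.sin θ ^ 2) := by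
      rw [hφ2, eq_div_iff hΔne, sub_mul, div_mul_cancel₀ _ hΔne]
      linear_combination (-1 : ℝ) * hmR - Rmax ^ 2 * m * hsc
    have hprod : (φ θ ^ 2 - Rmin ^ 2) * (Rmax ^ 2 - φ θ ^ 2)
        = (Rmin * Rmax * m * Real.sin θ * Real.cos θ / (1 - m * Real.sin θ ^ 2)) ^ 2 := by
      rw [hA, hB]
      ring
    have hroot : Real.sqrt ((φ θ ^ 2 - Rmin ^ 2) * (Rmax ^ 2 - φ θ ^ 2))
        = Rmin * Rmax * m * Real.sin θ * Real.cos θ / (1 - m * Real.sin θ ^ 2) := by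
      rw [hprod, Real.sqrt_sq (div_nonneg
        (mul_pos (mul_pos (mul_pos (mul_pos h0 hRmax) hm0) hs) hc).le hΔ.le)]
    rw [smul_eq_mul, hg_def]
    dsimp only
    rw [hroot, hφ2, hφ'_def]
    dsimp only
    set u := Real.sqrt (1 - m * Real.sin θ ^ 2)
    have hune : u ≠ 0 := hsqpos.ne'
    rw [← hsq]
    field_simp
  -- assemble
  calc ∫ R in Rmin..Rmax, g R
      = ∫ R in Icc Rmin Rmax, g R := by
        rw [intervalIntegral.integral_of_le hle, integral_Icc_eq_integral_Ioc]
    _ = ∫ θ in Icc 0 (π / 2), φ' θ • g (φ θ) := step1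
    _ = ∫ θ in Icc 0 (π / 2), Real.sqrt (1 - m * Real.sin θ ^ 2) / (Rmin ^ 2 * Rmax) := step2
    _ = (∫ θ in (0 : ℝ)..(π / 2), Real.sqrt (1 - m * Real.sin θ ^ 2)) / (Rmin ^ 2 * Rmax) := by
        rw [integral_Icc_eq_integral_Ioc, ← intervalIntegral.integral_of_le hpi,
          intervalIntegral.integral_div]
    _ = ellipticE (Real.sqrt m) / (Rmin ^ 2 * Rmax) := by
        simp only [ellipticE, Real.sq_sqrt hm0.le]

/-- **Lee–Cerfon (q4), last equality, as a theorem:** for `0 < R_min < R_max`,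
`(2q₀R₀³/π) ∫_{R_min}^{R_max} dR/(R²((R²−R_min²)(R_max²−R²))^{1/2}) = (2q₀/π)(R₀³/(R_min² R_max)) E(k)`,
`k = (1 − R_min²/R_max²)^{1/2}`. [cite: LeeCerfon2015, §4.1 eq. (q4)] -/
theorem qLCIntegral_eq_qLC (q₀ R₀ : ℝ) {Rmin Rmax : ℝ} (h0 : 0 < Rmin) (hlt : Rmin < Rmax) :
    qLCIntegral q₀ R₀ Rmin Rmax = qLC q₀ R₀ Rmin Rmax := by
  unfold qLCIntegral qLC
  rw [integral_qLC_kernel h0 hlt]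
  have hRmin : Rmin ≠ 0 := h0.ne'
  have hRmax : Rmax ≠ 0 := (h0.trans hlt).ne'
  field_simp

/-- **DISCHARGE of the named fact `QLCClosedForm`** (Lee–Cerfon (q4): the printed closed-form safety
factor of the CHEASE Solov'ev equilibrium equals its elliptic-type flux integral on every surface with
midplane radii `0 < R_min < R_max`), by the explicit substitution `R = R_min(1 − k² sin²θ)^{−1/2}` —
the step for which the source cites Gradshteyn–Ryzhik §3.156 formula 6.
[cite: LeeCerfon2015, §4.1 eq. (q4)] -/
theorem QLCClosedForm_holds : QLCClosedForm :=
  fun q₀ R₀ _ _ h0 hlt => qLCIntegral_eq_qLC q₀ R₀ h0 hlt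

end QLCDischarge

/-! ## (q4), first line → second line: the integrand on a flux surface of (solo2) (appended 2026-08-26, seat gridfusion-lit-4)

Elementary algebra recorded so that `qLCIntegral` (which types the SECOND line of (q4)) is tied to the FIRST line
`(F_B/π)∫ dR/(R|∂_ZΨ|)` on the typed object `psiLC`: on the surface through the midplane radii `R_min, R_max` one has
`R²Z²/κ² = ¼(R²−R_min²)(R_max²−R²)` and `R|∂_ZΨ| = (F_B/(2R₀³q₀))R²((R²−R_min²)(R_max²−R²))^{1/2}`.
[cite: LeeCerfon2015, §4.1 eq. (q4); corpus arXiv:1409.3523 chunk p0013] -/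

section QLCSurface

/-- `∂Ψ/∂Z` of (solo2): `Ψ_Z = (κF_B/(2R₀³q₀))·2R²Z/κ²`. [cite: LeeCerfon2015, §4.1 eq. (solo2)] -/
theorem dZ_psiLC (κ FB R₀ q₀ a R Z : ℝ) :
    dZ (psiLC κ FB R₀ q₀ a) R Z = κ * FB / (2 * R₀ ^ 3 * q₀) * (2 * R ^ 2 / κ ^ 2) * Z := by
  set k := κ * FB / (2 * R₀ ^ 3 * q₀) with hk
  have hZsl : ∀ z, psiLC κ FB R₀ q₀ a R z = k * (1 / 4 * (R ^ 2 - R₀ ^ 2) ^ 2 - a ^ 2 * R₀ ^ 2)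
      + k * (R ^ 2 / κ ^ 2) * z ^ 2 + 0 * z ^ 4 + 0 * z ^ 6 := fun z => by unfold psiLC; rw [hk]; ring
  rw [lc_dZ_evenSextic hZsl Z]
  ring

/-- **On the flux surface of (solo2) through the midplane points `(R_min, 0)`, `(R_max, 0)`**
(`R_min² + R_max² = 2R₀²`, both are roots of `Ψ(·,0) = Ψ_s`): every point `(R, Z)` with `Ψ(R,Z) = Ψ_s`
satisfies `R²Z²/κ² = ¼(R² − R_min²)(R_max² − R²)` (`κ, F_B, R₀, q₀ ≠ 0`). This is the elementary
step between the first and the second line of (q4). [cite: LeeCerfon2015, §4.1 eq. (q4)] -/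
theorem psiLC_surface_RZ_sq {κ FB R₀ q₀ a Rmin Rmax R Z : ℝ} (hκ : κ ≠ 0) (hF : FB ≠ 0)
    (hR₀ : R₀ ≠ 0) (hq : q₀ ≠ 0) (h2 : Rmin ^ 2 + Rmax ^ 2 = 2 * R₀ ^ 2)
    (hs : psiLC κ FB R₀ q₀ a R Z = psiLC κ FB R₀ q₀ a Rmin 0) :
    R ^ 2 * Z ^ 2 / κ ^ 2 = 1 / 4 * ((R ^ 2 - Rmin ^ 2) * (Rmax ^ 2 - R ^ 2)) := by
  unfold psiLC at hs
  have hc : κ * FB / (2 * R₀ ^ 3 * q₀) ≠ 0 :=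
    div_ne_zero (mul_ne_zero hκ hF) (mul_ne_zero (mul_ne_zero two_ne_zero (pow_ne_zero 3 hR₀)) hq)
  have hA := mul_left_cancel₀ hc hs
  linear_combination hA + (1 / 4 * (Rmin ^ 2 - R ^ 2)) * h2

/-- **`(R ∂_ZΨ)² = (F_B/(2R₀³q₀))² R⁴ (R² − R_min²)(R_max² − R²)` on that surface.**
[cite: LeeCerfon2015, §4.1 eq. (q4)] -/
theorem psiLC_surface_sq_R_mul_dZ {κ FB R₀ q₀ a Rmin Rmax R Z : ℝ} (hκ : κ ≠ 0) (hF : FB ≠ 0)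
    (hR₀ : R₀ ≠ 0) (hq : q₀ ≠ 0) (h2 : Rmin ^ 2 + Rmax ^ 2 = 2 * R₀ ^ 2)
    (hs : psiLC κ FB R₀ q₀ a R Z = psiLC κ FB R₀ q₀ a Rmin 0) :
    (R * dZ (psiLC κ FB R₀ q₀ a) R Z) ^ 2
      = (FB / (2 * R₀ ^ 3 * q₀)) ^ 2 * R ^ 4 * ((R ^ 2 - Rmin ^ 2) * (Rmax ^ 2 - R ^ 2)) := by
  have h := psiLC_surface_RZ_sq hκ hF hR₀ hq h2 hs
  rw [dZ_psiLC]
  have h4 : (R ^ 2 - Rmin ^ 2) * (Rmax ^ 2 - R ^ 2) = 4 * (R ^ 2 * Z ^ 2 / κ ^ 2) := by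
    rw [h]; ring
  rw [h4]
  field_simp
  ring

/-- **The (q4) integrand identity** on that surface, at a point with `R > 0` strictly between the
midplane radii (`(R² − R_min²)(R_max² − R²) > 0`) and `F_B, R₀, q₀, κ > 0`:
`R|∂_ZΨ| = (F_B/(2R₀³q₀)) R² ((R² − R_min²)(R_max² − R²))^{1/2}`, hence
`F_B/(R|∂_ZΨ|) = 2q₀R₀³/(R²((R² − R_min²)(R_max² − R²))^{1/2})` — i.e. `(F_B/π)∫ dR/(R|∂_ZΨ|)` over
`[R_min, R_max]` IS `qLCIntegral q₀ R₀ R_min R_max`. [cite: LeeCerfon2015, §4.1 eq. (q4)] -/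
theorem psiLC_surface_integrand {κ FB R₀ q₀ a Rmin Rmax R Z : ℝ} (hκ : 0 < κ) (hF : 0 < FB)
    (hR₀ : 0 < R₀) (hq : 0 < q₀) (hR : 0 < R) (h2 : Rmin ^ 2 + Rmax ^ 2 = 2 * R₀ ^ 2)
    (hs : psiLC κ FB R₀ q₀ a R Z = psiLC κ FB R₀ q₀ a Rmin 0)
    (hin : 0 < (R ^ 2 - Rmin ^ 2) * (Rmax ^ 2 - R ^ 2)) :
    R * |dZ (psiLC κ FB R₀ q₀ a) R Z|
        = FB / (2 * R₀ ^ 3 * q₀) * R ^ 2 * Real.sqrt ((R ^ 2 - Rmin ^ 2) * (Rmax ^ 2 - R ^ 2)) ∧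
      FB / (R * |dZ (psiLC κ FB R₀ q₀ a) R Z|)
        = 2 * q₀ * R₀ ^ 3 / (R ^ 2 * Real.sqrt ((R ^ 2 - Rmin ^ 2) * (Rmax ^ 2 - R ^ 2))) := by
  have hsq := psiLC_surface_sq_R_mul_dZ hκ.ne' hF.ne' hR₀.ne' hq.ne' h2 hs
  have hroot : 0 < Real.sqrt ((R ^ 2 - Rmin ^ 2) * (Rmax ^ 2 - R ^ 2)) := Real.sqrt_pos.2 hin
  have h1 : R * |dZ (psiLC κ FB R₀ q₀ a) R Z|
      = FB / (2 * R₀ ^ 3 * q₀) * R ^ 2 * Real.sqrt ((R ^ 2 - Rmin ^ 2) * (Rmax ^ 2 - R ^ 2)) := by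
    have hl : R * |dZ (psiLC κ FB R₀ q₀ a) R Z| = Real.sqrt ((R * dZ (psiLC κ FB R₀ q₀ a) R Z) ^ 2) := by
      rw [Real.sqrt_sq_eq_abs, abs_mul, abs_of_pos hR]
    rw [hl, hsq, show (FB / (2 * R₀ ^ 3 * q₀)) ^ 2 * R ^ 4 = (FB / (2 * R₀ ^ 3 * q₀) * R ^ 2) ^ 2 by ring,
      Real.sqrt_mul (sq_nonneg _), Real.sqrt_sq (by positivity)]
  refine ⟨h1, ?_⟩
  rw [h1]
  field_simp

end QLCSurface

end Literature.MathematicalPhysics.MHD.Solovev
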